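import Summits.HodgeConjecture.CorCM.MultiFieldWeilUnitGramFour
import HarnessLib

/-!
# MULTI-FIELD WEIL ENGINE — NO UNIT OVER AN IMPRIMITIVE QUARTIC PART: a set of permutations preserving a pairing never separates two singletons, nor a single two-letter
# position set (census level, the honest limit «one `(1,3)`-class and no `(2,2)`-class per octic field of quartic part `C₄`, `V₄`, `D₄`» as a theorem)

Cell `pub-hodgecm2` (COR-CM), seat b30 gen 40 (2026-08-26); count-neutral own lane MULTI-FIELD WEIL ENGINE (stem `MultiFieldWeil*`), census level, companion of
`CorCM/MultiFieldWeilUnitSeparationSharp.lean` (G8: under a `2`-transitive image U1's criterion is an equivalence) and of `CorCM/MultiFieldWeilUnitsMenuImprimitive.lean`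
(G4: an octic field WITHOUT a degree-`24` pair carries ONE `(1,3)`-class in the menu).  Theorems only; no definition, no named fact, no `sorry`, no `decide`.  HONEST FRAMING: pure
finite combinatorics; `HC_CM` is NOT touched.

THE POINT.  U1's cell identity needs the image `H ⊆ Sym(4)` of `Aut(ℂ/τk)` on the `τ`-embeddings to be `2`-TRANSITIVE (quartic part `𝔄₄`/`𝔖₄`).  When the quartic part is
`C₄`, `V₄` or `D₄` the image preserves a PAIRING of the four letters (the fibres over the intermediate quadratic extension of `k`), and then the signed equations of two
singleton position sets `{q}, {q'}` (`q ≠ q'`; two CM fourfolds of `k`-signature `(1,3)` over the field) have a NON-CONSTANT solution although their centred indicators are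
linearly independent: with `v = +1` on one block and `−1` on the other (mass zero when the blocks have equal size), take
`u_q = v` and `u_{q'} = v` if `q, q'` lie in different blocks, `u_{q'} = −v` if they lie in the same block; since a block-preserving `σ` carries the two letters `σ⁻¹ q, σ⁻¹ q'`
to different ∕ equal blocks accordingly, `Σ_a ±_{σ a = q} v(a) ± Σ_a ±_{σ a = q'} v(a) = 2(v(σ⁻¹q) ± v(σ⁻¹q')) = 0`.  So the units method gives ONE class per such field and no
more — `exists_nonconst_signed_singletons_of_pairing`.  Likewise a SINGLE `(2,2)`-type does not separate under a pairing: across the blocks the block sign is a non-constant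
solution (`exists_nonconst_signed_pair_across_of_pairing`), on a whole block the defect `𝟙_x − 𝟙_y` is (`exists_nonconst_signed_block_of_pairing`) — consistent with
Shimura: a `(2,2)`-type over an octic field with imprimitive quartic part is not primitive.
[cite: DixonMortimer1996, §1.5 (blocks and systems of imprimitivity)] [cite: Lang2002, XIII §4]

## References
* [DixonMortimer1996] J. D. Dixon, B. Mortimer, *Permutation Groups*, GTM 163, §1.5 (blocks, imprimitive groups).
* [Lang2002] S. Lang, *Algebra*, GTM 211, XIII §4.
-/

noncomputable section

namespace Summit.HodgeConjecture.CorCM.MultiFieldWeil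

open Finset

open scoped Classical

section Pairing

variable {k : ℕ}

/-- The signed sum of a function of mass zero through a singleton position set: `Σ_a ±_{σ a = q} v(a) = 2·v(σ⁻¹ q)`. [folklore] -/
theorem sum_signed_singleton_eq (σ : Equiv.Perm (Fin k)) (q : Fin k) (v : Fin k → ℤ) (hv : (∑ a, v a) = 0) :
    (∑ a : Fin k, (if σ a ∈ ({q} : Finset (Fin k)) then v a else -v a)) = 2 * v (σ.symm q) := by
  have h : ∀ a : Fin k, (if σ a ∈ ({q} : Finset (Fin k)) then v a else -v a) = 2 * (if a = σ.symm q then v a else 0) - v a := fun a => by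
    by_cases ha : a = σ.symm q
    · have hmem : σ a ∈ ({q} : Finset (Fin k)) := Finset.mem_singleton.2 (by rw [ha, Equiv.apply_symm_apply])
      rw [if_pos hmem, if_pos ha]; ring
    · have hmem : σ a ∉ ({q} : Finset (Fin k)) := fun h => ha (by rw [← Finset.mem_singleton.1 h, Equiv.symm_apply_apply])
      rw [if_neg hmem, if_neg ha]; ring
  rw [Finset.sum_congr rfl fun a _ => h a, Finset.sum_sub_distrib, ← Finset.mul_sum, Finset.sum_ite_eq' Finset.univ (σ.symm q), if_pos (Finset.mem_univ _), hv, sub_zero]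

/-- **NO UNIT OVER AN IMPRIMITIVE QUARTIC PART.**  `H ⊆ Sym(k)` preserving a two-valued block function `β` (`β (σ a) = β (σ b) ↔ β a = β b`) whose two blocks have the
same size (so that `v = ±1` by block has mass zero), and two letters `q, q'`: there are integer defects `u_q, u_{q'}`, NOT constant, with
`Σ_a ±_{σ a = q} u_q(a) + Σ_a ±_{σ a = q'} u_{q'}(a) = 0` for every `σ ∈ H` — the signed equations of the singleton position sets `{q}, {q'}` do not force constancy, although
for `q ≠ q'` on `k ≥ 3` letters the two centred indicators are linearly independent (U2 §2 `linearIndependent_cells_of_singletons`).  On four letters with the pairing of an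
imprimitive quartic part this is the honest limit «one `(1,3)`-class per such octic field». [cite: DixonMortimer1996, §1.5] [cite: Lang2002, XIII §4] -/
theorem exists_nonconst_signed_singletons_of_pairing {H : Finset (Equiv.Perm (Fin k))} (β : Fin k → Bool)
    (hH : ∀ σ ∈ H, ∀ a b : Fin k, β (σ a) = β (σ b) ↔ β a = β b) (hβ : (∑ a : Fin k, (if β a then (1 : ℤ) else -1)) = 0) (q q' : Fin k) :
    ∃ u u' : Fin k → ℤ, (∃ b b', u b ≠ u b') ∧
      ∀ σ ∈ H, (∑ a : Fin k, (if σ a ∈ ({q} : Finset (Fin k)) then u a else -u a)) + (∑ a : Fin k, (if σ a ∈ ({q'} : Finset (Fin k)) then u' a else -u' a)) = 0 := by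
  -- the block sign `v = ±1`, of mass zero, not constant (there are letters of both signs since the mass is zero and `k ≥ 2`)
  let v : Fin k → ℤ := fun a => if β a then 1 else -1
  have hv : (∑ a, v a) = 0 := hβ
  have hvβ : ∀ a b : Fin k, v a = v b ↔ β a = β b := fun a b => by
    cases ha : β a <;> cases hb : β b <;> simp [v, ha, hb]
  have hvne : ∀ a b : Fin k, β a ≠ β b → v a = -v b := fun a b hab => by
    cases ha : β a <;> cases hb : β b <;> simp_all [v]
  -- two letters of different sign: `q` itself and some letter of the other block
  have hex : ∃ b, β b ≠ β q := by
    by_contra hno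
    push Not at hno
    have hall : ∀ a, v a = v q := fun a => (hvβ a q).2 (hno a)
    have hsum : (∑ a, v a) = (Fintype.card (Fin k) : ℤ) * v q := by
      rw [Finset.sum_congr rfl fun a _ => hall a, Finset.sum_const, Finset.card_univ, nsmul_eq_mul]
    rw [hv, Fintype.card_fin] at hsum
    have hk : (k : ℤ) ≠ 0 := by have := q.pos; exact_mod_cast (show k ≠ 0 by omega)
    have hvq : v q ≠ 0 := by cases hq : β q <;> simp [v, hq]
    exact mul_ne_zero hk hvq hsum.symm
  obtain ⟨b₀, hb₀⟩ := hex
  by_cases hsame : β q = β q'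
  · -- same block: `u_q = v`, `u_{q'} = −v`
    refine ⟨v, fun a => -v a, ⟨b₀, q, fun h => hb₀ ((hvβ b₀ q).1 h)⟩, fun σ hσ => ?_⟩
    have hneg : (∑ a : Fin k, (if σ a ∈ ({q'} : Finset (Fin k)) then -v a else -(-v a))) = -(∑ a : Fin k, (if σ a ∈ ({q'} : Finset (Fin k)) then v a else -v a)) := by
      rw [← Finset.sum_neg_distrib]
      refine Finset.sum_congr rfl fun a _ => ?_
      split_ifs <;> ring
    rw [hneg, sum_signed_singleton_eq σ q v hv, sum_signed_singleton_eq σ q' v hv]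
    have hb : β (σ.symm q) = β (σ.symm q') := by
      have h := (hH σ hσ (σ.symm q) (σ.symm q')).1 (by rw [Equiv.apply_symm_apply, Equiv.apply_symm_apply]; exact hsame)
      exact h
    rw [(hvβ _ _).2 hb]
    ring
  · -- different blocks: `u_q = u_{q'} = v`
    refine ⟨v, v, ⟨b₀, q, fun h => hb₀ ((hvβ b₀ q).1 h)⟩, fun σ hσ => ?_⟩
    rw [sum_signed_singleton_eq σ q v hv, sum_signed_singleton_eq σ q' v hv]
    have hb : β (σ.symm q) ≠ β (σ.symm q') := fun h => hsame (by
      have h' := (hH σ hσ (σ.symm q) (σ.symm q')).2 h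
      rwa [Equiv.apply_symm_apply, Equiv.apply_symm_apply] at h')
    rw [hvne _ _ hb]
    ring

/-- The signed sum of a function of mass zero through a two-letter position set: `Σ_a ±_{σ a ∈ {x,y}} v(a) = 2·(v(σ⁻¹ x) + v(σ⁻¹ y))` (`x ≠ y`). [folklore] -/
theorem sum_signed_pair_eq (σ : Equiv.Perm (Fin k)) {x y : Fin k} (hxy : x ≠ y) (v : Fin k → ℤ) (hv : (∑ a, v a) = 0) :
    (∑ a : Fin k, (if σ a ∈ ({x, y} : Finset (Fin k)) then v a else -v a)) = 2 * (v (σ.symm x) + v (σ.symm y)) := by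
  have hne : σ.symm x ≠ σ.symm y := fun h => hxy (σ.symm.injective h)
  have h : ∀ a : Fin k, (if σ a ∈ ({x, y} : Finset (Fin k)) then v a else -v a) =
      2 * (if a = σ.symm x then v a else 0) + 2 * (if a = σ.symm y then v a else 0) - v a := fun a => by
    by_cases hx : a = σ.symm x
    · have hmem : σ a ∈ ({x, y} : Finset (Fin k)) := Finset.mem_insert.2 (Or.inl (by rw [hx, Equiv.apply_symm_apply]))
      have hy : a ≠ σ.symm y := fun h => hne (hx.symm.trans h)
      rw [if_pos hmem, if_pos hx, if_neg hy]; ring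
    · by_cases hy : a = σ.symm y
      · have hmem : σ a ∈ ({x, y} : Finset (Fin k)) := Finset.mem_insert.2 (Or.inr (Finset.mem_singleton.2 (by rw [hy, Equiv.apply_symm_apply])))
        rw [if_pos hmem, if_neg hx, if_pos hy]; ring
      · have hmem : σ a ∉ ({x, y} : Finset (Fin k)) := fun h => by
          rcases Finset.mem_insert.1 h with h | h
          · exact hx (by rw [← h, Equiv.symm_apply_apply])
          · exact hy (by rw [← Finset.mem_singleton.1 h, Equiv.symm_apply_apply])
        rw [if_neg hmem, if_neg hx, if_neg hy]; ring
  rw [Finset.sum_congr rfl fun a _ => h a, Finset.sum_sub_distrib, Finset.sum_add_distrib, ← Finset.mul_sum, ← Finset.mul_sum,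
    Finset.sum_ite_eq' Finset.univ (σ.symm x), Finset.sum_ite_eq' Finset.univ (σ.symm y), if_pos (Finset.mem_univ _), if_pos (Finset.mem_univ _), hv, sub_zero, mul_add]

/-- **NO `(2,2)`-CLASS ACROSS THE BLOCKS.**  `H` preserving the two-valued block function `β` with blocks of equal size; a two-letter position set `{x, y}` with `x, y` in
DIFFERENT blocks: the block sign `v = ±1` is a non-constant defect whose signed sums vanish on `H`. [cite: DixonMortimer1996, §1.5] -/
theorem exists_nonconst_signed_pair_across_of_pairing {H : Finset (Equiv.Perm (Fin k))} (β : Fin k → Bool)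
    (hH : ∀ σ ∈ H, ∀ a b : Fin k, β (σ a) = β (σ b) ↔ β a = β b) (hβ : (∑ a : Fin k, (if β a then (1 : ℤ) else -1)) = 0) {x y : Fin k} (hxy : β x ≠ β y) :
    ∃ u : Fin k → ℤ, (∃ b b', u b ≠ u b') ∧ ∀ σ ∈ H, (∑ a : Fin k, (if σ a ∈ ({x, y} : Finset (Fin k)) then u a else -u a)) = 0 := by
  let v : Fin k → ℤ := fun a => if β a then 1 else -1
  have hvne : ∀ a b : Fin k, β a ≠ β b → v a = -v b := fun a b hab => by
    cases ha : β a <;> cases hb : β b <;> simp_all [v]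
  have hxy' : x ≠ y := fun h => hxy (by rw [h])
  refine ⟨v, ⟨x, y, fun h => ?_⟩, fun σ hσ => ?_⟩
  · have := hvne x y hxy
    rw [this] at h
    have hy : v y ≠ 0 := by cases hb : β y <;> simp [v, hb]
    omega
  · rw [sum_signed_pair_eq σ hxy' v hβ]
    have hb : β (σ.symm x) ≠ β (σ.symm y) := fun h => hxy (by
      have h' := (hH σ hσ (σ.symm x) (σ.symm y)).2 h
      rwa [Equiv.apply_symm_apply, Equiv.apply_symm_apply] at h')
    rw [hvne _ _ hb]
    ring

/-- **NO `(2,2)`-CLASS ON A BLOCK.**  `H` preserving the two-valued block function `β`; the position set `{x, y}` a WHOLE block (`x ≠ y`, `β b = β x ↔ b ∈ {x, y}` — on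
four letters: the fibre over one embedding of the intermediate quadratic field): the defect `𝟙_x − 𝟙_y` is non-constant and its signed sums vanish on `H`.
[cite: DixonMortimer1996, §1.5] -/
theorem exists_nonconst_signed_block_of_pairing {H : Finset (Equiv.Perm (Fin k))} (β : Fin k → Bool)
    (hH : ∀ σ ∈ H, ∀ a b : Fin k, β (σ a) = β (σ b) ↔ β a = β b) {x y : Fin k} (hxy : x ≠ y) (hbl : ∀ b : Fin k, β b = β x ↔ (b = x ∨ b = y)) :
    ∃ u : Fin k → ℤ, (∃ b b', u b ≠ u b') ∧ ∀ σ ∈ H, (∑ a : Fin k, (if σ a ∈ ({x, y} : Finset (Fin k)) then u a else -u a)) = 0 := by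
  have hβxy : β x = β y := ((hbl y).2 (Or.inr rfl)).symm
  let u : Fin k → ℤ := fun a => (if a = x then 1 else 0) - (if a = y then 1 else 0)
  have hu : (∑ a, u a) = 0 := by
    simp only [u, Finset.sum_sub_distrib, Finset.sum_ite_eq', Finset.mem_univ, if_true, sub_self]
  have hux : u x = 1 := by simp [u, hxy]
  have huy : u y = -1 := by simp [u, hxy.symm]
  refine ⟨u, ⟨x, y, by rw [hux, huy]; omega⟩, fun σ hσ => ?_⟩
  rw [sum_signed_pair_eq σ hxy u hu]
  have hne : σ.symm x ≠ σ.symm y := fun h => hxy (σ.symm.injective h)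
  have hββ : β (σ.symm x) = β (σ.symm y) := (hH σ hσ _ _).1 (by rw [Equiv.apply_symm_apply, Equiv.apply_symm_apply]; exact hβxy)
  by_cases hbx : β (σ.symm x) = β x
  · -- the block is carried to itself: `{σ⁻¹x, σ⁻¹y} = {x, y}`
    rcases (hbl _).1 hbx with h1 | h1 <;> rcases (hbl _).1 (hββ.symm.trans hbx) with h2 | h2
    · exact absurd (h1.trans h2.symm) hne
    · rw [h1, h2, hux, huy]; ring
    · rw [h1, h2, hux, huy]; ring
    · exact absurd (h1.trans h2.symm) hne
  · -- the block is carried to the other block: all indicators vanish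
    have hby : β (σ.symm y) ≠ β x := fun h => hbx (hββ.trans h)
    have hx1 : σ.symm x ≠ x := fun h => hbx (by rw [h])
    have hx2 : σ.symm x ≠ y := fun h => hbx (by rw [h, hβxy])
    have hy1 : σ.symm y ≠ x := fun h => hby (by rw [h])
    have hy2 : σ.symm y ≠ y := fun h => hby (by rw [h, hβxy])
    simp only [u, if_neg hx1, if_neg hx2, if_neg hy1, if_neg hy2]
    ring

end Pairing

end Summit.HodgeConjecture.CorCM.MultiFieldWeil

end
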